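/-
HONEST FRAMING: certified error envelopes and provably optimal rounding/accumulation schemes for
low-precision formats under stated cost models; every table by two implementations; no hardware
or vendor claims.
-/
import Summits.Ventures.CertifiedArithmetic.LowPrec.OptDemotionEveryTree
import Summits.Ventures.CertifiedArithmetic.LowPrec.OptDemotionTreeWitnessFormats

/-!
# The demotion law (Theorem T8), part 5g: Conjecture D in the formats (distinct exponent floors)

`OptDemotionEveryTree.exact_le_treeQf_mul_fl` is stated, as OPTIMA T8 is, for the nested model
formats `F(p, emin) ⊂ F(q, emin)` with a COMMON exponent floor.  Two formats of the venture have
different floors (`qexp`), and the demoted value may underflow in the narrow format — where no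
relative statement can hold (`fl_p` of a tiny positive sum may vanish).  THIS FILE gives the
version that applies to the formats themselves:

* `exact_le_treeQf_mul_fl_of_normal` — wide rounding into `F(q, emin_q)`, narrow rounding into
  `F(p, emin_p)` with ANY two floors; if the computed wide sum is a normal number of the narrow
  format (`2^(emin_p + p - 1) ≤ ŝ`), then `s ≤ Q_t · fl_p(ŝ)` for every tree with `M_t(u_q) ≤ 2`;
* `exact_le_treeQf_flJR` — the same for two `Format`s `α` (wide) and `β` (narrow) rounding to
  nearest even (`Format.flJR`, gradual underflow, no overflow): e.g. binary32 accumulation stored to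
  bfloat16 or binary16, binary16 stored to FP8 — for every summation tree with `M_t(u_α) ≤ 2` whose
  binary32/binary16 sum is β-normal, the stored result under-estimates the exact sum of the
  nonnegative data by at most the factor `1 - 1/Q_t`, and (part 4, `demotion_tree_witness_flJR`)
  this is attained for every tree.
-/

namespace Summit.Ventures.CertifiedArithmetic.LowPrec.Opt

open Literature.ComputerArithmetic.JeannerodRump2018
open Literature.ComputerArithmetic.JeannerodRump2018.SumTree
open Literature.ComputerArithmetic.FloatingPoint

/-- CONJECTURE D UPPER BOUND WITH TWO EXPONENT FLOORS: wide accumulation in `F(q, emin_q)` (any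
nearest rounding), one final rounding into `F(p, emin_p)` (any nearest rounding, any floor); if the
computed sum is a normal number of the narrow format then `s ≤ Q_t · fl_p(ŝ)` for every tree with
`M_t(u_q) ≤ 2` and nonnegative data. -/
theorem exact_le_treeQf_mul_fl_of_normal {p q : ℕ} (hp : 1 ≤ p) (hq : 1 ≤ q) {eminq eminp : ℤ}
    {flq flp : ℚ → ℚ} (hflq : IsRoundNearest q eminq flq) (hflp : IsRoundNearest p eminp flp)
    (t : SumTree) (ht : ∀ x ∈ leaves t, IsFloat q eminq x ∧ 0 ≤ x) (hM : treeM (unitRoundoff q) t ≤ 2)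
    (hnormal : (2 : ℚ) ^ (eminp + p - 1) ≤ eval flq t) :
    exact t ≤ treeQf (unitRoundoff q) t (unitRoundoff p) * flp (eval flq t) := by
  set u := unitRoundoff q with hu
  set P := unitRoundoff p with hP
  have hu0 : 0 ≤ u := unitRoundoff_nonneg q
  have hu1 : u ≤ 1 := unitRoundoff_le_one q
  have hupos : 0 < u := by rw [hu]; unfold unitRoundoff; positivity
  have hP0 : 0 < P := by rw [hP]; unfold unitRoundoff; positivity
  obtain ⟨-, hposcase⟩ := deficit_line_bound hq hflq t ht hM
  set v := eval flq t with hv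
  have hpos : 0 < v := lt_of_lt_of_le (zpow_pos (by norm_num) _) hnormal
  obtain ⟨l, hl, hdef⟩ := hposcase hpos
  obtain ⟨hL0, hLA, -⟩ := goodLines_bounds hu0 hu1 t l hl
  have hQ : 1 + P + l.1 + l.2 * P ≤ treeQf u t P := line_le_treeQf hupos t l hl P hP0
  set K := Int.log 2 v with hK
  have hvlo : ((2 : ℕ) : ℚ) ^ K ≤ v := Int.zpow_log_le_self (by norm_num) hpos
  have hvhi : v < ((2 : ℕ) : ℚ) ^ (K + 1) := Int.lt_zpow_succ_log_self (by norm_num) v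
  push_cast at hvlo hvhi
  have hσpos : (0 : ℚ) < (2 : ℚ) ^ K := zpow_pos (by norm_num) _
  have hQ0 : 0 ≤ treeQf u t P := by nlinarith
  have hex : exact t ≤ v + (2 : ℚ) ^ K * (l.1 - l.2) + l.2 * v := by linarith
  have hKe : eminp + p ≤ K + 1 := by
    by_contra hlt
    have : (2 : ℚ) ^ (K + 1) ≤ (2 : ℚ) ^ (eminp + (p : ℤ) - 1) :=
      zpow_le_zpow_right₀ (by norm_num) (by omega)
    linarith
  have herr := abs_sub_fl_le_half_ulp hp hflp hvlo hvhi hKe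
  have hr_ge : (2 : ℚ) ^ K ≤ flp v :=
    le_fl_of_isFloat_le hflp (PTree.isFloat_two_zpow hp (by omega)) hvlo
  have hr_lo : v - P * (2 : ℚ) ^ K ≤ flp v := by
    have := (abs_le.mp herr).2; rw [hP]; linarith
  rcases le_or_gt v ((2 : ℚ) ^ K + P * (2 : ℚ) ^ K) with hA | hB
  · have h1 : exact t ≤ (1 + P + l.1 + l.2 * P) * (2 : ℚ) ^ K := by
      nlinarith [mul_le_mul_of_nonneg_left hA (by linarith : (0 : ℚ) ≤ 1 + l.2)]
    calc exact t ≤ (1 + P + l.1 + l.2 * P) * (2 : ℚ) ^ K := h1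
      _ ≤ treeQf u t P * (2 : ℚ) ^ K := mul_le_mul_of_nonneg_right hQ hσpos.le
      _ ≤ treeQf u t P * flp v := mul_le_mul_of_nonneg_left hr_ge hQ0
  · have hgap : 0 ≤ v - (2 : ℚ) ^ K - P * (2 : ℚ) ^ K := by linarith
    have hcoef : 0 ≤ l.1 - l.2 + P * (1 + l.2) := by nlinarith
    have h1 : exact t ≤ (1 + P + l.1 + l.2 * P) * (v - P * (2 : ℚ) ^ K) := by
      nlinarith [mul_nonneg hgap hcoef]
    have hline0 : 0 ≤ 1 + P + l.1 + l.2 * P := by nlinarith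
    calc exact t ≤ (1 + P + l.1 + l.2 * P) * (v - P * (2 : ℚ) ^ K) := h1
      _ ≤ (1 + P + l.1 + l.2 * P) * flp v := mul_le_mul_of_nonneg_left hr_lo hline0
      _ ≤ treeQf u t P * flp v := mul_le_mul_of_nonneg_right hQ (le_trans hσpos.le hr_ge)

/-- **CONJECTURE D IN THE FORMATS (round-to-nearest-even, gradual underflow, no overflow).**  Wide
format `α` (`q = m_α + 1` bits, floor `qexp α`), narrow format `β` (`p = m_β + 1`, floor `qexp β`):
for every summation tree `t` with `M_t(u_α) ≤ 2`, all nonnegative data in `F(q, qexp α)` and a wide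
computed sum `ŝ = eval α.flJR t` that is `β`-normal (`2^(qexp β + p - 1) ≤ ŝ`):
`s ≤ Q_t · β.flJR(ŝ)` with `Q_t = treeQf u_α t u_β`. -/
theorem exact_le_treeQf_flJR (α β : Format) (t : SumTree)
    (ht : ∀ x ∈ leaves t, IsFloat (α.manBits + 1) α.qexp x ∧ 0 ≤ x)
    (hM : treeM (unitRoundoff (α.manBits + 1)) t ≤ 2)
    (hnormal : (2 : ℚ) ^ (β.qexp + ((β.manBits + 1 : ℕ) : ℤ) - 1) ≤ eval α.flJR t) :
    exact t ≤ treeQf (unitRoundoff (α.manBits + 1)) t (unitRoundoff (β.manBits + 1))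
      * β.flJR (eval α.flJR t) :=
  exact_le_treeQf_mul_fl_of_normal (by omega) (by omega) (Format.isRoundNearest_flJR α)
    (Format.isRoundNearest_flJR β) t ht hM hnormal

/-- Relative form in the formats: the stored narrow value under-estimates the exact sum by at most
the fraction `1 - 1/Q_t`. -/
theorem demotion_flJR_relative (α β : Format) (t : SumTree)
    (ht : ∀ x ∈ leaves t, IsFloat (α.manBits + 1) α.qexp x ∧ 0 ≤ x)
    (hM : treeM (unitRoundoff (α.manBits + 1)) t ≤ 2)
    (hnormal : (2 : ℚ) ^ (β.qexp + ((β.manBits + 1 : ℕ) : ℤ) - 1) ≤ eval α.flJR t) :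
    exact t - β.flJR (eval α.flJR t)
      ≤ (1 - 1 / treeQf (unitRoundoff (α.manBits + 1)) t (unitRoundoff (β.manBits + 1))) * exact t := by
  have h := exact_le_treeQf_flJR α β t ht hM hnormal
  have hu0 : 0 ≤ unitRoundoff (α.manBits + 1) := unitRoundoff_nonneg _
  have hupos : 0 < unitRoundoff (α.manBits + 1) := by unfold unitRoundoff; positivity
  have hP0 : 0 < unitRoundoff (β.manBits + 1) := by unfold unitRoundoff; positivity
  have hQ : 0 < treeQf (unitRoundoff (α.manBits + 1)) t (unitRoundoff (β.manBits + 1)) := by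
    have := line_le_treeQf hupos t _ (mu_mem_goodLines hu0 (unitRoundoff_le_one _) t)
      (unitRoundoff (β.manBits + 1)) hP0
    have hM1 := one_le_treeM hu0 t
    dsimp only at this; nlinarith
  rw [sub_mul, one_mul, div_mul_eq_mul_div, one_mul, sub_le_sub_iff_left, div_le_iff₀ hQ]
  linarith

/-- THE NORMALITY THRESHOLDS of the standard demotion pairs (the hypothesis `2^(qexp β + p - 1) ≤ ŝ`
is "`ŝ` is at least the smallest normal number of `β`"): bfloat16 `2^-126`, binary16 `2^-14`,
E5M2 `2^-14`, E4M3 `2^-6`. -/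
theorem demotion_normal_thresholds :
    Format.BFloat16.qexp + ((Format.BFloat16.manBits + 1 : ℕ) : ℤ) - 1 = -126 ∧
    Format.Binary16.qexp + ((Format.Binary16.manBits + 1 : ℕ) : ℤ) - 1 = -14 ∧
    Format.E5M2.qexp + ((Format.E5M2.manBits + 1 : ℕ) : ℤ) - 1 = -14 ∧
    Format.E4M3.qexp + ((Format.E4M3.manBits + 1 : ℕ) : ℤ) - 1 = -6 := by
  refine ⟨?_, ?_, ?_, ?_⟩ <;> decide

end Summit.Ventures.CertifiedArithmetic.LowPrec.Opt
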